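import Literature.Geometry.Kaehler.HodgeStarFrame

/-!
# Naturality of the pointwise Hodge star under linear isometries

For a linear isometric isomorphism `φ : E ≃ₗᵢ[ℝ] F` of oriented `n`-dimensional real inner
product spaces and the transported orientation `o.map φ`, the Hodge star commutes with pull-back:

* `hodgeStar_map_comp`: `φ^* (⋆_{o.map φ} β) = ⋆_o (φ^* β)` for every `k`-form `β` on `F`
  (`k + m = n`), where `φ^* γ = γ.compContinuousLinearMap φ`;
* `hodgeStar_comp_of_orientation`: for an *arbitrary* orientation `o'` of `F`,
  `φ^* (⋆_{o'} β) = ± ⋆_o (φ^* β)`, the sign being `+` iff `o' = o.map φ`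
  (`hodgeStar_comp_eq_or_eq_neg`).

This is the linear algebra underneath every "compute `⋆` in an adapted frame / in osculating
coordinates" argument (Warner, GTM 94, Ch. 2, Exercise 13: `*` is characterised by its values on
*any* positively oriented orthonormal basis, hence is equivariant under orientation-preserving
isometries; Voisin (2002), §5.1.1 and proof of Prop. 6.5, p. 140, where `⋆` near a point is read
in a frame osculating the flat one). Proof: write `⋆` as the frame sum of an orthonormal basis
`b` of `E` and of its image `b.map φ` (`hodgeStar_eq_hodgeStarFrame`, the discharged fact
`hodgeStar_apply_eq_sum`), use the naturality of frame sums
(`hodgeStarFrame_compContinuousLinearMap`) and Mathlib's `Orientation.volumeForm_map`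
(`vol_{o.map φ} (φ ∘ v) = vol_o v`).

## References

* F. W. Warner, *Foundations of Differentiable Manifolds and Lie Groups*, GTM 94 (1983), Ch. 2,
  Exercise 13, pp. 79–80. [WarnerGTM94]
* C. Voisin, *Hodge Theory and Complex Algebraic Geometry I* (2002), §5.1.1; §6.1.1, proof of
  Prop. 6.5 (p. 140). [Voisin2002]
-/

noncomputable section

open Module ContinuousAlternatingMap Function

namespace Literature.Geometry.Kaehler

section Naturality

variable {E F : Type*} [NormedAddCommGroup E] [InnerProductSpace ℝ E] [FiniteDimensional ℝ E]
  [NormedAddCommGroup F] [InnerProductSpace ℝ F] [FiniteDimensional ℝ F]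
  {n : ℕ} [Fact (finrank ℝ E = n)] [Fact (finrank ℝ F = n)]
  (o : Orientation ℝ E (Fin n)) {k m : ℕ}

omit [FiniteDimensional ℝ E] [FiniteDimensional ℝ F] in
/-- The volume form of the transported orientation pulls back to the volume form:
`(vol_{o.map φ}) ∘ φ = vol_o` (Mathlib's `Orientation.volumeForm_map`, as an identity of
continuous alternating maps). [folklore] -/
theorem volumeFormL_map_compContinuousLinearMap (φ : E ≃ₗᵢ[ℝ] F) :
    ((Orientation.map (Fin n) φ.toLinearEquiv o).volumeFormL).compContinuousLinearMap
        (φ : E →L[ℝ] F) = o.volumeFormL := by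
  ext v
  rw [compContinuousLinearMap_apply, Orientation.volumeFormL_apply, Orientation.volumeFormL_apply,
    Orientation.volumeForm_map]
  congr 1
  funext i
  simp

/-- **Naturality of the Hodge star under linear isometries.** For a linear isometric
isomorphism `φ : E ≃ₗᵢ[ℝ] F` of `n`-dimensional inner product spaces, an orientation `o` of `E`
and the transported orientation `o.map φ` of `F`: `φ^*(⋆_{o.map φ} β) = ⋆_o(φ^* β)` for every
`k`-form `β` on `F` (`k + m = n`). Warner, GTM 94, Ch. 2, Ex. 13 (the star is determined by any
positively oriented orthonormal basis); used implicitly in Voisin (2002), proof of Prop. 6.5.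
[cite: WarnerGTM94, Ch. 2 Ex. 13, pp. 79-80] -/
theorem hodgeStar_map_comp (φ : E ≃ₗᵢ[ℝ] F) (h : k + m = n) (β : F [⋀^Fin k]→L[ℝ] ℝ) :
    (hodgeStar (Orientation.map (Fin n) φ.toLinearEquiv o) h β).compContinuousLinearMap
        (φ : E →L[ℝ] F) =
      hodgeStar o h (β.compContinuousLinearMap (φ : E →L[ℝ] F)) := by
  set b : OrthonormalBasis (Fin n) ℝ E := stdOrthonormalBasisFin E n
  have hb : (⇑(b.map φ) : Fin n → F) = (φ : E →L[ℝ] F) ∘ ⇑b := by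
    funext i
    simp [b]
  rw [hodgeStar_eq_hodgeStarFrame _ (b.map φ), hodgeStar_eq_hodgeStarFrame o b, hb,
    hodgeStarFrame_compContinuousLinearMap, volumeFormL_map_compContinuousLinearMap]

/-- Naturality for an arbitrary orientation `o'` of the target: `φ^*(⋆_{o'} β) = ⋆_o(φ^*β)` if
`o' = o.map φ` and `= -⋆_o(φ^*β)` otherwise (any two orientations of `F` agree up to sign,
`Orientation.eq_or_eq_neg`, and `⋆_{-o} = -⋆_o`, `hodgeStar_neg_orientation`). [folklore] -/
theorem hodgeStar_comp_eq_or_eq_neg (o' : Orientation ℝ F (Fin n)) (φ : E ≃ₗᵢ[ℝ] F)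
    (h : k + m = n) (β : F [⋀^Fin k]→L[ℝ] ℝ) :
    (hodgeStar o' h β).compContinuousLinearMap (φ : E →L[ℝ] F) =
        hodgeStar o h (β.compContinuousLinearMap (φ : E →L[ℝ] F)) ∨
      (hodgeStar o' h β).compContinuousLinearMap (φ : E →L[ℝ] F) =
        -hodgeStar o h (β.compContinuousLinearMap (φ : E →L[ℝ] F)) := by
  rcases Orientation.eq_or_eq_neg o' (Orientation.map (Fin n) φ.toLinearEquiv o)
      (by simpa using (Fact.out : finrank ℝ F = n).symm) with rfl | rfl
  · exact Or.inl (hodgeStar_map_comp o φ h β)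
  · right
    rw [hodgeStar_neg_orientation, LinearMap.neg_apply, ← hodgeStar_map_comp o φ h β]
    ext v
    simp

open Classical in
/-- Naturality with the sign made explicit and **uniform in the degree**: for orientations `o`
of `E`, `o'` of `F` and a linear isometric isomorphism `φ`, put `ε = 1` if `o' = o.map φ` and
`ε = -1` otherwise; then `φ^*(⋆_{o'} β) = ε • ⋆_o(φ^* β)` for forms `β` of *every* degree `k`.
(So in composites with two stars, such as `∂̄* = -⋆∂⋆`, the signs cancel.) [folklore] -/
theorem hodgeStar_comp_eq_ite_smul (o' : Orientation ℝ F (Fin n)) (φ : E ≃ₗᵢ[ℝ] F)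
    (h : k + m = n) (β : F [⋀^Fin k]→L[ℝ] ℝ) :
    (hodgeStar o' h β).compContinuousLinearMap (φ : E →L[ℝ] F) =
      (if o' = Orientation.map (Fin n) φ.toLinearEquiv o then (1 : ℝ) else -1) •
        hodgeStar o h (β.compContinuousLinearMap (φ : E →L[ℝ] F)) := by
  split_ifs with ho
  · subst ho
    rw [one_smul, hodgeStar_map_comp]
  · have ho' : o' = -Orientation.map (Fin n) φ.toLinearEquiv o :=
      (Orientation.eq_or_eq_neg o' (Orientation.map (Fin n) φ.toLinearEquiv o)
        (by simpa using (Fact.out : finrank ℝ F = n).symm)).resolve_left ho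
    subst ho'
    rw [hodgeStar_neg_orientation, LinearMap.neg_apply, ← hodgeStar_map_comp o φ h β]
    ext v
    simp

end Naturality

end Literature.Geometry.Kaehler
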